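import Literature.Probability.LatticeModels.SharpLengthDCPTorusScreened
import Literature.Probability.LatticeModels.CriticalTwoPointDCPLowerHolds
import HarnessLib

/-!
# Screened reflected-gradient inequality from the screened torus Lemma 2.5
# (stub S1 `stub_screenedGradient` of line `source-cluster-screening`, crux stmt-CriticalPhenomena-15703
# `Summit.CriticalPhenomena.Ising3DConformalLimit.Theses.SubPtolemyInterlacing.SubPtolemyFloor`)

What: for every `s ≥ 0` and `C > 0`, the SCREENED torus Lemma 2.5 of the line (Duminil-Copin–Panis 2025,
arXiv:2404.05700, Lemma 2.5 at `β_c(3)`, SUMMED over the neighbour pairs `x ∼ y` of `Λ_n`, with the polynomial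
gain `C n^{-s}` in front of the printed right side, on every even torus `(ℤ/Lℤ)³`, `L ≥ 4n + 2`, and every
direction) implies the SCREENED reflected-gradient inequality (Theorem 1.2 at `β_c(3)` with the gain carried):
`c₀ n^{s} ≤ Σ_{x,y ∈ Λ_n, y ∼ x} (⟨σ₀σ_x⟩ - ⟨σ₀σ_{𝓡_n x}⟩)⟨σ_yσ_{𝓡_n y}⟩` for `n ≥ N₀`, with
`c₀ = 1/(24 β_c C)`, `N₀ = max(2, ⌈6 C₀⌉)` (`C₀` the infrared-bound constant). Hypothesis and conclusion are
the line's propositions `ScreenedTorusLemma25 s C` and `ScreenedReflectedGradient s`, unfolded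
(`screenedGradient_of_screenedLemma25`).

How (§2.2 of the source with the gain carried through, following the tree's
`DCPNearCritical.reflectedGradient_nearCritical_of_lemma25` at `d = 3`, `β = β_c`): the torus integration and
the limit along the even tori with Lemma 2.5 summed over the pairs and a gain `κ` in front
(`DCPNearCritical.infiniteVolume_ineq_of_lemma25_sum`, `Literature/Probability/LatticeModels/SharpLengthDCPTorusScreened.lean`;
`m*(β_c) = 0`, and `L(β_c) = ∞` makes the sharp-length input `w = 2β_c` of eq. (2.5) available for all
`n ≥ 2`), with `κ = C n^{-s}`; the symmetry over the `6` directions (`DCPNearCritical.direction_sum_const`);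
Lemma 2.4 proper through the infrared bound
(`twoPointFree_le_of_le_criticalBeta`: `6 ⟨σ₀σ_{2ne₁}⟩_{β_c} ≤ 1/2` for `n ≥ N₀`), whence
`1/2 ≤ 12 β_c C n^{-s} S`, i.e. `n^{s}/(24 β_c C) ≤ S`.

References: H. Duminil-Copin, R. Panis, *New lower bounds for the (near) critical Ising and φ⁴ models'
two-point functions*, CMP 406 (2025), arXiv:2404.05700, Theorem 1.2 and §2.2 (Lemmas 2.4–2.5,
eqs. (2.5)–(2.8), (2.20)–(2.24)) [DuminilCopinPanis2025LowerBounds].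
-/

noncomputable section

open Finset Filter Topology

namespace Summit.CriticalPhenomena.Ising3DConformalLimit.SubPtolemyFloorScreening

open Literature.Probability.LatticeModels Literature.Probability.LatticeModels.DCPLower
  Literature.Probability.LatticeModels.DCPNearCritical
open scoped ENNReal symmDiff Classical

/-- **S1.** For every `s ≥ 0` and `C > 0`: the screened torus Lemma 2.5 (summed over neighbour pairs of
`Λ_n`, gain `C n^{-s}`, all even tori `L ≥ 4n+2`, all directions) implies the screened reflected-gradient
inequality `c₀ n^{s} ≤ Σ_{x,y∈Λ_n, y∼x} (⟨σ₀σ_x⟩ - ⟨σ₀σ_{𝓡_n x}⟩)⟨σ_yσ_{𝓡_n y}⟩` at `β_c(3)` for `n ≥ N₀`.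
(Hypothesis and conclusion are the line's `ScreenedTorusLemma25 s C` / `ScreenedReflectedGradient s`,
unfolded.) [cite: DuminilCopinPanis2025LowerBounds, Theorem 1.2 and §2.2 (Lemmas 2.4–2.5, eqs. (2.5)–(2.8), (2.20)–(2.24))] -/
theorem screenedGradient_of_screenedLemma25 (s C : ℝ) (hs : 0 ≤ s) (hC : 0 < C)
    (hE : ∀ (n : ℕ) (_hn : 1 ≤ n) (L : ℕ) [NeZero L] (hL : Even L) (hnL : 4 * n + 2 ≤ L) (δ : Fin 3 × Bool),
      (∑ x ∈ box 3 n, ∑ y ∈ box 3 n,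
        if (zdGraph 3).Adj x y then
          ∑' nc : edgesIn (torusGraph 3 L) univ → ℕ,
            ind (csources (torusGraph 3 L) univ nc = ∅ ∧
                CSupp (torusGraph 3 L) univ (edgesIn (torusGraph 3 L) univ) nc) *
              cweight (torusGraph 3 L) univ (criticalBeta 3) nc *
              (ind (¬ (isFoldable_dir hL (by omega) n δ).ConnFix ((isFoldable_dir hL (by omega) n δ).fold nc)
                      (Torus.proj L (0 : Site 3)) ∧
                    ¬ (isFoldable_dir hL (by omega) n δ).ConnFix ((isFoldable_dir hL (by omega) n δ).fold nc)
                      (Torus.proj L x) ∧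
                    (isFoldable_dir hL (by omega) n δ).ConnFix ((isFoldable_dir hL (by omega) n δ).fold nc)
                      (Torus.proj L y)) *
                ENNReal.ofReal (isingTwoPoint (torusGraph 3 L)
                  (((box 3 n).filter fun z => ¬ (isFoldable_dir hL (by omega) n δ).ConnFix
                      ((isFoldable_dir hL (by omega) n δ).fold nc) (Torus.proj L z)).image (Torus.proj L))
                  (criticalBeta 3) 0 .free (Torus.proj L (0 : Site 3)) (Torus.proj L x)))
        else 0) ≤
      ENNReal.ofReal (C * (n : ℝ) ^ (-s)) *
        ∑ x ∈ box 3 n, ∑ y ∈ box 3 n,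
          if (zdGraph 3).Adj x y then
            (currentZ (torusGraph 3 L) univ (criticalBeta 3) (edgesIn (torusGraph 3 L) univ)
                  ({Torus.proj L (0 : Site 3)} ∆ {Torus.proj L x}) -
                currentZ (torusGraph 3 L) univ (criticalBeta 3) (edgesIn (torusGraph 3 L) univ)
                  ({Torus.proj L (0 : Site 3)} ∆ {dirTheta L n δ (Torus.proj L x)})) *
              ENNReal.ofReal (isingTwoPoint (torusGraph 3 L) univ (criticalBeta 3) 0 .free (Torus.proj L y)
                (dirTheta L n δ (Torus.proj L y)))
          else 0) :
    ∃ c₀ : ℝ, 0 < c₀ ∧ ∃ N₀ : ℕ, 0 < N₀ ∧ ∀ n : ℕ, N₀ ≤ n →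
      c₀ * (n : ℝ) ^ s ≤ ∑ x ∈ box 3 n, ∑ y ∈ box 3 n,
        if (zdGraph 3).Adj x y then
          (twoPointFree 3 (criticalBeta 3) x -
              twoPointFree 3 (criticalBeta 3) (dcpReflect (⟨0, by omega⟩ : Fin 3) (n : ℤ) x)) *
            freeExpect 3 (criticalBeta 3) 0
              (spinPair y (dcpReflect (⟨0, by omega⟩ : Fin 3) (n : ℤ) y))
        else 0 := by
  -- adapted from `DCPNearCritical.reflectedGradient_nearCritical_of_lemma25` at `d = 3`, `β = β_c`
  have hd : 3 ≤ 3 := le_rfl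
  set i₀ : Fin 3 := ⟨0, by omega⟩ with hi₀
  have hβ : 0 ≤ criticalBeta 3 := criticalBeta_nonneg 3
  have hβpos : 0 < criticalBeta 3 := criticalBeta_pos_holds (d := 3) (by norm_num)
  obtain ⟨C₀, hC₀, hIR⟩ := twoPointFree_le_of_le_criticalBeta (d := 3) hd
  obtain ⟨N₀, hN₀2, hN₀C⟩ : ∃ N₀ : ℕ, 2 ≤ N₀ ∧ C₀ * (2 * 3) ≤ N₀ :=
    ⟨max 2 ⌈C₀ * (2 * 3)⌉₊, le_max_left _ _,
      (Nat.le_ceil _).trans (by exact_mod_cast le_max_right 2 ⌈C₀ * (2 * (3 : ℝ))⌉₊)⟩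
  have hc₀ : 0 < 1 / (24 * criticalBeta 3 * C) :=
    div_pos one_pos (mul_pos (mul_pos (by norm_num) hβpos) hC)
  refine ⟨1 / (24 * criticalBeta 3 * C), hc₀, N₀, by omega, fun n hn => ?_⟩
  have hn2 : 2 ≤ n := hN₀2.trans hn
  have hn1 : 1 ≤ n := by omega
  have hnpos : (0 : ℝ) < n := by exact_mod_cast (show 0 < n by omega)
  have hm : spontaneousMagnetization 3 (criticalBeta 3) = 0 :=
    spontaneousMagnetization_eq_zero_of_le_criticalBeta hd hβ le_rfl
  -- the gain, the effective weight `2β_c · C n^{-s}`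
  have hns1 : 1 ≤ (n : ℝ) ^ s := Real.one_le_rpow (by exact_mod_cast hn1) hs
  have hns : 0 ≤ (n : ℝ) ^ s := zero_le_one.trans hns1
  have hnms : 0 ≤ (n : ℝ) ^ (-s) := Real.rpow_nonneg hnpos.le (-s)
  have hκ : 0 ≤ C * (n : ℝ) ^ (-s) := mul_nonneg hC.le hnms
  have hk1 : (n : ℝ) ^ s * (n : ℝ) ^ (-s) = 1 := by
    rw [← Real.rpow_add hnpos, add_neg_cancel, Real.rpow_zero]
  -- the sharp-length input `w = 2β_c` (`L(β_c) = ∞`)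
  have hsl : (n : ℕ∞) ≤ sharpLength 3 (criticalBeta 3) := by
    rw [sharpLength_criticalBeta_eq_top (d := 3) hd]
    exact le_top
  have hw : (0 : ℝ) ≤ 2 * criticalBeta 3 := mul_nonneg zero_le_two hβ
  -- the infinite-volume inequality with `w = 2β_c`, `κ = C n^{-s}`, summed over the directions
  have hineq := infiniteVolume_ineq_of_lemma25_sum (κ := C * (n : ℝ) ^ (-s)) hβ hm hn1 hw hκ
    (sharpLength_input (d := 3) hn2 hsl) (hE n hn1)
  rw [direction_sum_const (criticalBeta 3) (2 * criticalBeta 3 * (C * (n : ℝ) ^ (-s))) i₀ n] at hineq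
  have h3cast : ((3 : ℕ) : ℝ) = 3 := by norm_num
  rw [h3cast] at hineq
  -- Lemma 2.4: the head term is small by the infrared bound
  set x₀ : Site 3 := dirRefl (i₀, true) (n : ℤ) 0 with hx₀
  have hx₀i : x₀ i₀ = 2 * n := by
    rw [hx₀, dirRefl_apply, if_pos rfl]
    simp
  have hnorm : (2 * n : ℝ) ≤ ‖x₀‖ := by
    have h1 : ‖x₀ i₀‖ ≤ ‖x₀‖ := norm_le_pi_norm x₀ i₀
    rw [hx₀i, Int.norm_eq_abs] at h1
    push_cast at h1
    rw [abs_of_nonneg (by positivity)] at h1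
    exact h1
  have hx₀ne : x₀ ≠ 0 := by
    intro h
    have := congrFun h i₀
    rw [hx₀i] at this
    simp at this
    omega
  have hnormpos : (0 : ℝ) < ‖x₀‖ := lt_of_lt_of_le (by positivity) hnorm
  have hGsmall : twoPointFree 3 (criticalBeta 3) x₀ ≤ 1 / (4 * 3) := by
    have h1 := hIR (criticalBeta 3) hβ le_rfl x₀ hx₀ne
    have hinv1 : 1 / ‖x₀‖ ≤ 1 := by
      rw [div_le_one hnormpos]
      exact le_trans (by norm_cast; omega) hnorm
    have hpow : (1 / ‖x₀‖) ^ (3 - 2) ≤ 1 / ‖x₀‖ :=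
      pow_le_of_le_one (by positivity) hinv1 (by omega)
    have hinv2 : 1 / ‖x₀‖ ≤ 1 / (2 * n) := one_div_le_one_div_of_le (by positivity) hnorm
    have hC' : C₀ * (1 / (2 * n)) ≤ 1 / (4 * 3) := by
      rw [mul_one_div, div_le_div_iff₀ (by positivity) (by positivity)]
      have : (N₀ : ℝ) ≤ n := by exact_mod_cast hn
      nlinarith
    calc twoPointFree 3 (criticalBeta 3) x₀ ≤ C₀ * (1 / ‖x₀‖) ^ (3 - 2) := h1
      _ ≤ C₀ * (1 / ‖x₀‖) := mul_le_mul_of_nonneg_left hpow hC₀.le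
      _ ≤ C₀ * (1 / (2 * n)) := mul_le_mul_of_nonneg_left hinv2 hC₀.le
      _ ≤ 1 / (4 * 3) := hC'
  -- identify the sum with the printed one
  have hS : ∑ x ∈ box 3 n, ∑ y ∈ box 3 n,
      (if (zdGraph 3).Adj x y then
        (twoPointFree 3 (criticalBeta 3) x - twoPointFree 3 (criticalBeta 3) (dirRefl (i₀, true) n x)) *
          twoPointFree 3 (criticalBeta 3) (dirRefl (i₀, true) n y - y) else 0) =
      ∑ x ∈ box 3 n, ∑ y ∈ box 3 n,
        (if (zdGraph 3).Adj x y then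
          (twoPointFree 3 (criticalBeta 3) x - twoPointFree 3 (criticalBeta 3) (dcpReflect i₀ (n : ℤ) x)) *
            freeExpect 3 (criticalBeta 3) 0 (spinPair y (dcpReflect i₀ (n : ℤ) y)) else 0) := by
    have hfe : ∀ y z : Site 3, freeExpect 3 (criticalBeta 3) 0 (spinPair y z) =
        twoPointFree 3 (criticalBeta 3) (z - y) :=
      fun y z => freePair_eq_twoPointFree_sub hβ y z
    refine Finset.sum_congr rfl fun x _ => Finset.sum_congr rfl fun y _ => ?_
    rw [hfe, dirRefl_true_eq_dcpReflect, dirRefl_true_eq_dcpReflect]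
  rw [hS] at hineq
  set S := ∑ x ∈ box 3 n, ∑ y ∈ box 3 n,
        (if (zdGraph 3).Adj x y then
          (twoPointFree 3 (criticalBeta 3) x - twoPointFree 3 (criticalBeta 3) (dcpReflect i₀ (n : ℤ) x)) *
            freeExpect 3 (criticalBeta 3) 0 (spinPair y (dcpReflect i₀ (n : ℤ) y)) else 0) with hSdef
  -- conclude: `1 ≤ 6 (G(x₀) + 2β_c κ S)` and `6 G(x₀) ≤ 1/2`, so `1/2 ≤ 12 β_c C n^{-s} S`
  have h2 : 2 * (3 : ℝ) * twoPointFree 3 (criticalBeta 3) x₀ ≤ 1 / 2 := by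
    calc 2 * (3 : ℝ) * twoPointFree 3 (criticalBeta 3) x₀ ≤ 2 * 3 * (1 / (4 * 3)) :=
          mul_le_mul_of_nonneg_left hGsmall (by positivity)
      _ = 1 / 2 := by norm_num
  have h3 : 1 / 2 ≤ 12 * criticalBeta 3 * (C * (n : ℝ) ^ (-s)) * S := by nlinarith [hineq, h2]
  rw [div_mul_eq_mul_div, one_mul, div_le_iff₀ (mul_pos (mul_pos (by norm_num) hβpos) hC)]
  calc (n : ℝ) ^ s = 2 * ((n : ℝ) ^ s * (1 / 2)) := by ring
    _ ≤ 2 * ((n : ℝ) ^ s * (12 * criticalBeta 3 * (C * (n : ℝ) ^ (-s)) * S)) :=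
        mul_le_mul_of_nonneg_left (mul_le_mul_of_nonneg_left h3 hns) zero_le_two
    _ = 24 * criticalBeta 3 * C * S * ((n : ℝ) ^ s * (n : ℝ) ^ (-s)) := by ring
    _ = S * (24 * criticalBeta 3 * C) := by rw [hk1]; ring

end Summit.CriticalPhenomena.Ising3DConformalLimit.SubPtolemyFloorScreening

end
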